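import Summits.KontsevichZagierPeriods.KontsevichZagierPeriods.Theses.MultivaluedCoV
import Summits.KontsevichZagierPeriods.KontsevichZagierPeriods.Theorems.HurwitzMicroSectorsNormalFormPrincipleSplitGlue

/-!
# Route MultivaluedCoV — `MultiCoVKernelSplitGlue` (stmt-KontsevichZagierPeriods-17833):
# `AyoubPiLocalKernel → AyoubPiCancellation → MultiCoVKernel`

Pure proof file for the support item `MultiCoVKernelSplitGlue` of route
KontsevichZagierPeriods/MultivaluedCoV (rev 2): the glue of the crux-strategist's `[π]`-localisation
split of the deciding crux `MultiCoVKernel` (stmt-KontsevichZagierPeriods-2873). Its two hypotheses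
are, verbatim, the bodies of the shared items stmt-KontsevichZagierPeriods-0541 (`AyoubPiLocalKernel`:
for every pinned product `P n r = [π] ⋆ r`, every value-zero formal combination becomes a KZ relation
after finitely many `P`-multiplications — Conjecture 1 for the period ring LOCALISED at `[π]`,
Kontsevich–Zagier 2001 §4.1, Ayoub 2014 Def. 6 / Conj. 7) and stmt-KontsevichZagierPeriods-0540
(`AyoubPiCancellation`: `P`-multiplication reflects relations; transcendence-free, motivic shadow open:
Huber–Wüstholz 2022 App. A.4).

Proof (self-contained against the Literature API and one landed lemma):
1. `changeOfVariablesRel_subset_multiCoVRel` — rule (2) of the calculus IS the one-sheet (`N = 1`,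
   `σ₀ = r.domain`) multivalued change of variables: the ten side conditions of the relator are
   discharged one by one (sheet semialgebraic = `r.isSemialgebraic_domain`; exhaustion and co-nullity
   are `r.domain ∖ r.domain = ∅`, `Φ '' r.domain = r'.domain`; the integrand identity is the rule-(2)
   identity under `Fin.sum_univ_one` / `Set.indicator_of_mem`; `[r] − 1 • [r'] = [r] − [r']`).
2. `relations_le_plusClosure` — hence `KZ.relations ≤ closure ((1a) ∪ (1b) ∪ (3) ∪ multivalued CoV)`
   (`AddSubgroup.closure_le`, generator by generator).
3. `multiCoVKernelSplitGlue_proof` — the item BY NAME: a pinned product exists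
   (`HurwitzMicroSectors.NormalFormPrincipleSplitGlue.exists_pinnedProduct`, landed; so neither
   `∀ P`-hypothesis is consumed vacuously); for `c ∈ ker eval` the `π`-local kernel gives
   `(lift (of ∘ P))^[N] c ∈ KZ.relations`, `π`-cancellation peels the `N` factors (induction on `N`,
   left-nested iterates `Function.iterate_succ_apply'`), and step 2 moves `c ∈ KZ.relations` into the
   KZ⁺ closure, which is `MultiCoVKernel` unfolded.

Deliberately NOT here: any claim about items 0541 / 0540 themselves (open; 0541 is of period-conjecture
strength, 0540 is the effective-versus-localised seam), nor about `SheetTransfer`. Exactness of the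
cut modulo the engine (`MultiCoVKernel ∧ SheetTransfer → 0541 ∧ 0540`, through the summit and the
landed `LiouvilleUnfolding` dictionaries) is not needed and not restated.
Sources: M. Kontsevich, D. Zagier, *Periods* (2001), §1.2 rule (2) and Conjecture 1, §4.1
(`P̂ = P[(2πi)⁻¹]`); J. Ayoub, *Periods and the conjectures of Grothendieck and Kontsevich–Zagier*,
EMS Newsl. 91 (2014), Def. 6 / Conj. 7; A. Huber, G. Wüstholz, *Transcendence and linear relations of
1-periods* (2022), App. A.4.
-/

noncomputable section

namespace Summit.KontsevichZagierPeriods.MultivaluedCoV.MultiCoVKernelSplitGlue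

open Set MeasureTheory
open Literature.NumberTheory.Transcendental
open Summit.KontsevichZagierPeriods.KontsevichZagierPeriods.Theses.MultivaluedCoV
  (MultiCoVKernel SheetTransfer AyoubPiLocalKernel AyoubPiCancellation MultiCoVKernelSplitGlue)

/-! ## KZ⁺: the enlarged generator set -/

/-- The multivalued change-of-variables relators `[σ, Σ_k 1_{σ_k}·(g ∘ Φ_k)·|det Φ_k'|] − N·[τ, g]`
(the fourth generator set inside `MultiCoVKernel`, copied verbatim). [cite: KontsevichZagier2001, §1.2 rule (2)] -/
def multiCoVRel : Set KZ.FormalRep :=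
  {c | ∃ (n N : ℕ) (r r' : Literature.NumberTheory.Transcendental.KZ.IntegralRep n) (σ : Fin N → Set (Fin n → ℝ)) (Φ : Fin N → (Fin n → ℝ) → (Fin n → ℝ)) (Φ' : Fin N → (Fin n → ℝ) → ((Fin n → ℝ) →L[ℝ] (Fin n → ℝ))), (∀ k, Literature.ModelTheory.ExponentialFields.IsSemialgebraic ℚ (σ k)) ∧ (∀ k, σ k ⊆ r.domain) ∧ MeasureTheory.volume (r.domain \ ⋃ k, σ k) = 0 ∧ (∀ k, Literature.NumberTheory.Transcendental.IsSemialgebraicMapOn ℚ (σ k) (Φ k)) ∧ (∀ k, ∀ x ∈ σ k, HasFDerivWithinAt (Φ k) (Φ' k x) (σ k) x) ∧ (∀ k, Set.InjOn (Φ k) (σ k)) ∧ (∀ k, Φ k '' σ k ⊆ r'.domain) ∧ (∀ k, MeasureTheory.volume (r'.domain \ Φ k '' σ k) = 0) ∧ (∀ x ∈ ⋃ k, σ k, r.integrand x = ∑ k : Fin N, (σ k).indicator (fun y => r'.integrand (Φ k y) * |(Φ' k y).det|) x) ∧ c = Literature.NumberTheory.Transcendental.KZ.of r - N • Literature.NumberTheory.Transcendental.KZ.of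 r'}

/-- The relations of the enlarged calculus KZ⁺: generated by (1a), (1b), (3) and the multivalued
change-of-variables relators. [cite: KontsevichZagier2001, §1.2] -/
def plusClosure : AddSubgroup KZ.FormalRep :=
  AddSubgroup.closure (KZ.domainAddRel ∪ KZ.integrandAddRel ∪ KZ.newtonLeibnizRel ∪ multiCoVRel)

/-- **Rule (2) is the one-sheet multivalued change of variables.** A `changeOfVariablesRel` instance
`(r, r', Φ, Φ')` is the relator with `N = 1`, the single sheet `σ₀ = r.domain` and the map `Φ`: the
sheet is `ℚ`-semialgebraic and exhausts the domain, `Φ` is semialgebraic, differentiable within the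
sheet and injective on it, its image is exactly `r'.domain` (so co-null there), the integrand identity
is `f x = f' (Φ x)·|det Φ' x|` on the sheet, and `[r] − 1 • [r'] = [r] − [r']`.
[cite: KontsevichZagier2001, §1.2 rule (2)] -/
theorem changeOfVariablesRel_subset_multiCoVRel : KZ.changeOfVariablesRel ⊆ multiCoVRel := by
  rintro c ⟨n, r, r', Φ, Φ', hsa, hder, hinj, hdom, hf, rfl⟩
  refine ⟨n, 1, r, r', fun _ => r.domain, fun _ => Φ, fun _ => Φ', ?_, ?_, ?_, ?_, ?_, ?_, ?_, ?_, ?_, ?_⟩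
  · intro _; exact r.isSemialgebraic_domain
  · intro _; exact Subset.rfl
  · simp [Set.iUnion_const]
  · intro _; exact hsa
  · intro _ x hx; exact hder x hx
  · intro _; exact hinj
  · intro _; rw [hdom]
  · intro _; simp [hdom]
  · intro x hx
    have hx' : x ∈ r.domain := by simpa [Set.iUnion_const] using hx
    simp [Set.indicator_of_mem hx', hf x hx']
  · simp

/-- **Every KZ relation is a KZ⁺ relation**: (1a), (1b), (3) are generators of both, and rule (2) is
the one-sheet relator (`changeOfVariablesRel_subset_multiCoVRel`). [cite: KontsevichZagier2001, §1.2] -/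
theorem relations_le_plusClosure : KZ.relations ≤ plusClosure := by
  refine (AddSubgroup.closure_le _).mpr ?_
  rintro c (((hc | hc) | hc) | hc)
  · exact AddSubgroup.subset_closure (Or.inl (Or.inl (Or.inl hc)))
  · exact AddSubgroup.subset_closure (Or.inl (Or.inl (Or.inr hc)))
  · exact AddSubgroup.subset_closure (Or.inr (changeOfVariablesRel_subset_multiCoVRel hc))
  · exact AddSubgroup.subset_closure (Or.inl (Or.inr hc))

/-! ## The glue item by name -/

/-- **Settles stmt-KontsevichZagierPeriods-17833** (`MultiCoVKernelSplitGlue :=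
AyoubPiLocalKernel → AyoubPiCancellation → MultiCoVKernel`), the glue of the `[π]`-localisation split
of the deciding crux `MultiCoVKernel`: pinned product (`exists_pinnedProduct`) → `π`-local kernel gives
`(lift (of ∘ P))^[N] c ∈ KZ.relations` for `c ∈ ker eval` → `π`-cancellation peels the `N` factors
(induction on `N`) → `relations_le_plusClosure` (rule (2) is the one-sheet multivalued change of
variables). [cite: Ayoub2014, Def. 6 and Conj. 7] -/
theorem multiCoVKernelSplitGlue_proof : MultiCoVKernelSplitGlue := by
  unfold Summit.KontsevichZagierPeriods.KontsevichZagierPeriods.Theses.MultivaluedCoV.MultiCoVKernelSplitGlue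
  intro h₁ h₂
  unfold Summit.KontsevichZagierPeriods.KontsevichZagierPeriods.Theses.MultivaluedCoV.AyoubPiLocalKernel at h₁
  unfold Summit.KontsevichZagierPeriods.KontsevichZagierPeriods.Theses.MultivaluedCoV.AyoubPiCancellation at h₂
  -- a pinned product `[π] ⋆ ·` exists
  obtain ⟨P, hP⟩ :=
    Summit.KontsevichZagierPeriods.HurwitzMicroSectors.NormalFormPrincipleSplitGlue.exists_pinnedProduct
  intro c hc
  -- 0541: some `[π]^N ⋆ c` is a KZ relation
  obtain ⟨N, hN⟩ := h₁ P hP c hc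
  -- 0540 peels the `N` factors `[π]`
  have hrel : c ∈ KZ.relations := by
    clear hc
    induction N with
    | zero => simpa using hN
    | succ N ih =>
      exact ih (h₂ P hP _ (by simpa only [Function.iterate_succ_apply'] using hN))
  -- KZ relations are KZ⁺ relations
  exact relations_le_plusClosure hrel

/-- The same implication with the three route decls unapplied (interface form, for `--glue-by`):
`AyoubPiLocalKernel → AyoubPiCancellation → MultiCoVKernel`. [folklore] -/
theorem MultiCoVKernel_of_subs : AyoubPiLocalKernel → AyoubPiCancellation → MultiCoVKernel :=
  multiCoVKernelSplitGlue_proof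

end Summit.KontsevichZagierPeriods.MultivaluedCoV.MultiCoVKernelSplitGlue

end
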